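import Summits.NavierStokesRegularity.NavierStokesRegularity.Theorems.FluidComputerCalibration
import HarnessLib

/-!
# Fluid computer blueprint — CALIBRATION II: a pump cascade is a dyadically clocked blow-up profile, no more

HONEST FRAMING: low prior, high value-of-information experiment on Tao's machine paradigm; NOT a
claim that NS blows up. Nothing here constructs a pump cascade; this file MEASURES what the richer
interface `Literature.Analysis.FluidPDE.FluidComputer.PumpCascade S` (one `PumpGadget` per
generation with input/output classes `In`, `Out ⊆ L²`, the CONTEXT-FREE realisation axiom
`PumpGadget.fires` quantified over mild trajectories from EVERY datum, von Neumann
self-replication `replicate : Out n ⊆ In (n+1)`, and the spec sheet's energy floors and firing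
times) encodes beyond the bare `CascadeWitness` (calibrated in `FluidComputerCalibration.lean`).
Answer: exactly the spec sheet's CLOCKING of the blow-up, and still nothing of the machine.

* `exists_pumpCascade_of_clockedProfile`: let `U` be an `H¹⁰_df`-mild Navier–Stokes solution on
  `[0, S_m)` from a Schwartz divergence-free datum `u₀`, and `t : ℕ → ℝ` a schedule (`t 0 = 0`,
  monotone, `t n < S_m`) CLOCKED by the spec sheet `S` — `t (n+1) - t n ≤ C λ_n^{-α}` — along which
  `U` carries the spec's high-frequency energy floors — `∫_{|ξ| ≥ λ_n} |Û(s)(ξ)|² dξ ≥ E₀ ηⁿ` for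
  `s ∈ [t n, S_m)`. Then there IS a `PumpCascade S` with ignition datum `u₀` whose generation-`n`
  input class is the orbit tail `U([t n, S_m))` (output class `U([t (n+1), S_m))`, firing time
  `t (n+1) - t n`). The context-free axiom `fires` holds by time translation (`timeShift`) and
  uniqueness from the ENTRY STATE (`PerpetualPumpThesis.stub_uniqueness`): a trajectory from any
  datum that enters the orbit of `U` follows it. No maximality and no injectivity are needed;
  `replicate` is an equality. Robustness on an open class, leakage tolerance and self-replication
  OF A CLASS — the features that make Tao's programme a programme — are therefore INVISIBLE to the
  interface: a single orbit is an admissible "class".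
* With the forward theorems (`PumpCascade.lifespan_le`, `normBlowup_of_pumpCascade`; `α > 0`,
  `η > 1/4`) this pins `Nonempty (PumpCascade S)` between two phrasings of "some Schwartz datum has a
  mild Navier–Stokes solution with a dyadically clocked high-frequency energy cascade (hence finite
  lifespan `≤ T_*`)": the OUTPUT Tao's machine is designed to produce (J. Amer. Math. Soc. 29 (2016),
  §1.3; Prop. 6.3 (vii)–(ix) for the averaged equation), not the machine. Recorded in the
  blueprint's `ASSEMBLY.md` §2c.

## References

* T. Tao, *Finite time blowup for an averaged three-dimensional Navier–Stokes equation*, J. Amer.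
  Math. Soc. 29 (2016) 601–674, arXiv:1402.0290v3, §1.1 (1.15), §1.3 pp. 10–11, Prop. 6.3. [Tao2016AveragedNS]
-/

set_option linter.dupNamespace false

noncomputable section

open Set Filter Topology
open scoped SchwartzMap ENNReal

namespace Summit.NavierStokesRegularity.NavierStokesRegularity.Theorems.FluidComputer

open Literature.Analysis.FluidPDE Literature.Analysis.FluidPDE.Tao2016
open Literature.Analysis.FluidPDE.FluidComputer
open Literature.Analysis.FunctionSpaces (eFourierSobolevNorm)

/-- **Orbit following.** If a mild Navier–Stokes trajectory `u` (from any datum, on `[0,S')`) is at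
time `r ≥ 0` in the state `U ρ` of a mild trajectory `U` from an `H¹⁰_df`-attaining Schwartz datum
on `[0, S_m)` (`0 ≤ ρ`), then `u (r + δ) = U (ρ + δ)` for `0 ≤ δ < min (S' - r) (S_m - ρ)`: time
translation of both and uniqueness from the common state. -/
theorem orbit_follow {a b : L2C} {S' Sm r ρ δ : ℝ} {u U : ℝ → L2C}
    (hu : IsMildSolutionFor eulerForm a (Ico 0 S') u)
    (hU : IsMildSolutionFor eulerForm b (Ico 0 Sm) U) (hr : 0 ≤ r) (hρ : 0 ≤ ρ)
    (heq : U ρ = u r) (hδ : 0 ≤ δ) (hδS' : r + δ < S') (hδSm : ρ + δ < Sm) :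
    u (r + δ) = U (ρ + δ) := by
  have hu' : IsMildSolutionFor AveragingDatum.euler.form (u r) (Ico 0 (S' - r))
      (fun s => u (r + s)) := by
    refine timeShift AveragingDatum.euler (a := a) ?_ hr
    rwa [Literature.Barriers.NavierStokesRegularity.AveragedTypeI.euler_form_eq]
  have hU' : IsMildSolutionFor AveragingDatum.euler.form (u r) (Ico 0 (Sm - ρ))
      (fun s => U (ρ + s)) := by
    rw [← heq]
    refine timeShift AveragingDatum.euler (a := b) ?_ hρ
    rwa [Literature.Barriers.NavierStokesRegularity.AveragedTypeI.euler_form_eq]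
  have hδm : δ < min (S' - r) (Sm - ρ) := lt_min (by linarith) (by linarith)
  exact PerpetualPumpThesis.stub_uniqueness AveragingDatum.euler (u r) (min (S' - r) (Sm - ρ)) _ _
    (hu'.mono (Ico_subset_Ico_right (min_le_left _ _)))
    (hU'.mono (Ico_subset_Ico_right (min_le_right _ _))) δ ⟨hδ, hδm⟩

/-- **Converse calibration for pump cascades.** An `H¹⁰_df`-mild Navier–Stokes solution `U` on
`[0, S_m)` from a Schwartz divergence-free datum `u₀`, together with a schedule `t` (`t 0 = 0`,
monotone, `t n < S_m`) clocked by the spec sheet (`t (n+1) - t n ≤ C λ_n^{-α}`) along which the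
spec's high-frequency energy floors hold on the orbit tails (`E₀ηⁿ ≤ ∫_{|ξ|≥λ_n} |Û(s)|²` for
`s ∈ [t n, S_m)`), yields a `PumpCascade S` with ignition datum `u₀` and input classes the orbit
tails `U([t n, S_m))`. HONEST READING: the interface cannot tell a fluid computer from a single
clocked blow-up orbit; all of Tao's programme lies in producing such an orbit. -/
theorem exists_pumpCascade_of_clockedProfile (S : CascadeSpecs)
    (u₀ : 𝓢(EuclideanSpace ℝ (Fin 3), EuclideanSpace ℝ (Fin 3)))
    (hdiv : VectorCalculus.IsDivFree ⇑u₀) {Sm : ℝ} (hSm : 0 < Sm) {U : ℝ → L2C}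
    (hU : IsMildSolutionFor eulerForm (schwartzL2 u₀) (Ico 0 Sm) U)
    (t : ℕ → ℝ) (ht0 : t 0 = 0) (htmono : Monotone t) (htlt : ∀ n, t n < Sm)
    (htime : ∀ n, t (n + 1) - t n ≤ S.Tmax n)
    (hfloor : ∀ n, ∀ s ∈ Ico (t n) Sm,
      ENNReal.ofReal (S.Emin n) ≤ highFreqEnergy (S.lam n) (U s)) :
    ∃ L : PumpCascade S, L.u₀ = u₀ ∧ ∀ n, (L.G n).In = U '' Ico (t n) Sm := by
  have h10 : MemH10df (schwartzL2 u₀) := PumpContinuationSchwartzData.memH10df_schwartzL2 u₀ hdiv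
  have htnn : ∀ n, 0 ≤ t n := fun n => by
    have h := htmono (Nat.zero_le n); rwa [ht0] at h
  -- context-free firing of the orbit-tail gadget of generation `n`
  have hfires : ∀ (n : ℕ) (a : L2C) (S' : ℝ) (u : ℝ → L2C),
      IsMildSolutionFor eulerForm a (Ico 0 S') u →
        ∀ r : ℝ, 0 ≤ r → u r ∈ U '' Ico (t n) Sm → r + (t (n + 1) - t n) < S' →
          ∃ s : ℝ, r ≤ s ∧ s ≤ r + (t (n + 1) - t n) ∧ u s ∈ U '' Ico (t (n + 1)) Sm := by
    rintro n a S' u hu r hr0 ⟨ρ, hρ, hUρ⟩ hrS'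
    -- wait until the orbit time `max ρ (t (n+1))`, i.e. `δ = max 0 (t (n+1) - ρ) ≤ T n`
    obtain ⟨δ, hδ0, hδT, hδnext, hδSm⟩ : ∃ δ : ℝ, 0 ≤ δ ∧ δ ≤ t (n + 1) - t n ∧
        t (n + 1) ≤ ρ + δ ∧ ρ + δ < Sm := by
      rcases le_total (t (n + 1)) ρ with h | h
      · exact ⟨0, le_rfl, sub_nonneg.2 (htmono n.le_succ), by linarith, by linarith [hρ.2]⟩
      · exact ⟨t (n + 1) - ρ, by linarith, by linarith [hρ.1], by linarith,
          by linarith [htlt (n + 1)]⟩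
    have heq : u (r + δ) = U (ρ + δ) :=
      orbit_follow hu hU hr0 ((htnn n).trans hρ.1) hUρ hδ0 (by linarith) hδSm
    exact ⟨r + δ, by linarith, by linarith, ρ + δ, ⟨hδnext, hδSm⟩, heq.symm⟩
  refine ⟨{ G := fun n =>
              { κ := S.lam n
                κ_nonneg := (S.lam_pos n).le
                In := U '' Ico (t n) Sm
                Out := U '' Ico (t (n + 1)) Sm
                Ein := S.Emin n
                in_floor := by
                  rintro v ⟨s, hs, rfl⟩
                  exact hfloor n s hs
                T := t (n + 1) - t n
                T_nonneg := sub_nonneg.2 (htmono n.le_succ)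
                fires := hfires n }
            scale := fun _ => rfl
            replicate := fun _ => Subset.rfl
            energy := fun _ => le_rfl
            time := htime
            u₀ := u₀
            divFree := hdiv
            memH10df := h10
            ignite := ⟨0, ⟨ht0.le, hSm⟩, initial_eq hU ⟨le_rfl, hSm⟩ h10⟩ }, rfl, fun _ => rfl⟩

/-- **The clocked profile forces blow-up by `T_*`** (round trip through the interface): under the
hypotheses of `exists_pumpCascade_of_clockedProfile` with `α > 0` and `η > 1/4`, every mild
Navier–Stokes trajectory from `u₀` has lifespan `≤ T_* = ∑ C λ_n^{-α}`; in particular `S_m ≤ T_*`. -/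
theorem lifespan_le_of_clockedProfile (S : CascadeSpecs) (hα : 0 < S.alpha) (hη : 1 / 4 < S.eta)
    (u₀ : 𝓢(EuclideanSpace ℝ (Fin 3), EuclideanSpace ℝ (Fin 3)))
    (hdiv : VectorCalculus.IsDivFree ⇑u₀) {Sm : ℝ} (hSm : 0 < Sm) {U : ℝ → L2C}
    (hU : IsMildSolutionFor eulerForm (schwartzL2 u₀) (Ico 0 Sm) U)
    (t : ℕ → ℝ) (ht0 : t 0 = 0) (htmono : Monotone t) (htlt : ∀ n, t n < Sm)
    (htime : ∀ n, t (n + 1) - t n ≤ S.Tmax n)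
    (hfloor : ∀ n, ∀ s ∈ Ico (t n) Sm,
      ENNReal.ofReal (S.Emin n) ≤ highFreqEnergy (S.lam n) (U s)) :
    Sm ≤ S.Tstar := by
  obtain ⟨L, hL, -⟩ := exists_pumpCascade_of_clockedProfile S u₀ hdiv hSm hU t ht0 htmono htlt
    htime hfloor
  subst hL
  exact L.lifespan_le hα hη hU

end Summit.NavierStokesRegularity.NavierStokesRegularity.Theorems.FluidComputer

end
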